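import Literature.Analysis.FluidPDE.TaoAveragedNondegeneracy
import HarnessLib

/-!
# Tao 2016, §3.2 / §3.9: the isosceles degeneracy of the Fourier coefficients `c_σ`, and the
# non-degeneracy (3.24) for every closed triangle with distinct input moduli

Analysis/FluidPDE support file (all results proved; **no definitions, no named facts**), sequel of
`TaoAveragedNondegeneracy.lean` (the coefficients `cSigma η n σ = c_{σ₁,σ₂,σ₃}(η)` of Tao's
trigonometric polynomial `Θ`, §3.9, and the non-degeneracy (3.24) AT the normalised configuration
`ξ⁰` of (3.7)). T. Tao, *Finite time blowup for an averaged three-dimensional Navier–Stokes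
equation*, J. Amer. Math. Soc. **29** (2016), 601–674 = arXiv:1402.0290v3 (held as
`paper:arxiv-1402.0290`; page numbers of that text). HONEST FRAMING: statements about the
coefficients of Tao's AVERAGED equation (a model), transcribing with proof two sentences the source
states without proof; nothing here concerns the true Navier–Stokes equations.

The source, §3.2 (p. 15), choosing the base frequencies: "it is necessary to ensure that
`ξ⁰₁, ξ⁰₂, ξ⁰₃` have distinct magnitudes in order to avoid a certain degeneracy later in the argument
(namely, the failure of (c-nondeg) below)"; §1 (footnote, p. 6): "In an earlier version of this
manuscript, no averaging over dilations was assumed, but it was pointed out to us by the referee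
that the non-degeneracy condition (c-nondeg) failed if one did not introduce dilation averaging";
Remark 3.5 (p. 20): "The averaging over dilation operators was only needed to place the base
frequencies `ξ⁰₁, ξ⁰₂, ξ⁰₃` in a location where the non-degeneracy condition (c-nondeg) held. This
condition in fact holds for generic `ξ⁰₁, ξ⁰₂, ξ⁰₃`". Here, for a closed triangle
`η₀ + η₁ + η₂ = 0` and a vector `n` (the coefficients `c_σ(η, n)` of `TaoAveragedNondegeneracy`):

* `cSigma_eq_zero_of_isosceles` — **the degeneracy**: on the equal-INPUT-moduli locus
  `‖η₀‖ = ‖η₁‖` the four coefficients with `σ₀ = σ₁` vanish identically (any `n`);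
  `cSigma_eq_of_isosceles_opposite` — the closed form of the other four
  (`(1/8i)·2σ₀·⟪(η₀/|η₀|) × n, η₁⟫`);
* `cSigma_ne_zero_of_triangle` — **(c-nondeg) for an ARBITRARY non-degenerate closed triangle with
  distinct input moduli**: if the side lengths satisfy the strict triangle inequalities, the triple
  product `⟪(η₀/|η₀|) × n, η₁⟫` is non-zero (any genuine normal `n` qualifies) and `‖η₀‖ ≠ ‖η₁‖`,
  then `c_σ(η, n) ≠ 0` for all eight `σ` — writing `a, b, c` for the side lengths,
  `c_σ · 16bc·i / A ∈ ±{2(b−a)(a+b+c), 2(a−b)(a+b−c), 2(a+b)(a−b+c), 2(a+b)(b−a+c)}`, so the strict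
  triangle inequalities dispose of every factor but `a − b`. Together: for closed non-degenerate
  triangles, (3.24) holds EXACTLY off the isosceles locus `‖η₀‖ = ‖η₁‖` — "distinct magnitudes" is
  needed for the input pair only, and Remark 3.5's "generic" is the complement of that locus;
* `norm_cSigma_ge_of_sum_eq_zero` — **the quantitative form**: for every closed triangle (no other
  hypothesis) `‖c_σ(η, n)‖ ≥ |A|·|a − b|·m/(8bc)` with `m = min(a+b−c, a−b+c, b−a+c)` the smallest
  triangle slack — the (3.24)-margin is LINEAR in the input-modulus gap `|a − b|`;
  `norm_cSigma_ge_of_sides_mem_Icc` — the corollary for triads with all sides in a window `[r, R]`,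
  `R < 2r` (the cascade's near-equilateral triads): `‖c_σ‖ ≥ |A|·(2r − R)·|a − b|/(8R²)`;
* tools: `inner_cross_udir_swap`, `inner_cross_udir_swap_general` (the two triple products in `c_σ`
  are proportional), `inner_udir_eq_of_isosceles`, `inner_udir_udir`, `inner_of_sum_eq_zero` (law of
  cosines in the closed triangle).

Context (one sentence): the Lean proofs below were first written for the NS-cut's averaged-equation
model ladder (harvest/h2, 2026-08-23, pub-ns-dss lead) and are re-homed here because both statements
concern the printed operator only.

## References

* T. Tao, J. Amer. Math. Soc. 29 (2016), 601–674, arXiv:1402.0290v3: §1 footnote p. 6; §3.2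
  (3.7) and p. 15; §3.7 footnote 6 p. 19; §3.9 (3.24) p. 20; Remark 3.5 p. 20.
  Key `Tao2016AveragedNS`.
-/

noncomputable section

open Real Matrix
open scoped RealInnerProductSpace

namespace Literature.Analysis.FluidPDE.Tao2016

/-- Coordinates of `u = ξ/|ξ|`. [folklore] -/
private theorem tao_udir_coord (ξ : EuclideanSpace ℝ (Fin 3)) (i : Fin 3) : udir ξ i = ‖ξ‖⁻¹ * ξ i := by
  simp [udir]

/-- `|x|² = x₀² + x₁² + x₂²`. [folklore] -/
private theorem tao_normSq_fin3 (x : EuclideanSpace ℝ (Fin 3)) : x 0 * x 0 + x 1 * x 1 + x 2 * x 2 = ‖x‖ ^ 2 := by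
  rw [← real_inner_fin3, real_inner_self_eq_norm_sq]

/-- Antisymmetry of the two triple products in `c_σ` on the isosceles locus:
`((η₁/|η₁|) × n) · η₀ = −((η₀/|η₀|) × n) · η₁` when `|η₀| = |η₁|`.
[cite: Tao2016AveragedNS, §3.9 p. 20 (the coefficients `c_σ`)] -/
theorem inner_cross_udir_swap (η₀ η₁ n : EuclideanSpace ℝ (Fin 3)) (hnorm : ‖η₀‖ = ‖η₁‖) :
    ⟪cross (udir η₁) n, η₀⟫ = -⟪cross (udir η₀) n, η₁⟫ := by
  simp only [real_inner_fin3, cross_apply_zero, cross_apply_one, cross_apply_two, tao_udir_coord, hnorm]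
  ring

/-- Equality of the two cosines in `c_σ` on the isosceles locus:
`(η₁/|η₁|)·(η₂/|η₂|) = (η₀/|η₀|)·(η₂/|η₂|)` when `η₀ + η₁ + η₂ = 0` and `|η₀| = |η₁|`.
[cite: Tao2016AveragedNS, §3.9 p. 20 (the coefficients `c_σ`)] -/
theorem inner_udir_eq_of_isosceles (η₀ η₁ η₂ : EuclideanSpace ℝ (Fin 3)) (hsum : η₀ + η₁ + η₂ = 0)
    (hnorm : ‖η₀‖ = ‖η₁‖) :
    ⟪udir η₁, udir η₂⟫ = ⟪udir η₀, udir η₂⟫ := by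
  have h2 : η₂ = -η₀ - η₁ := by
    rw [← sub_eq_zero]; rw [← hsum]; abel
  have hsq0 := tao_normSq_fin3 η₀
  have hsq1 := tao_normSq_fin3 η₁
  rw [hnorm] at hsq0
  have e2 : ∀ i : Fin 3, η₂ i = -η₀ i - η₁ i := by
    intro i; rw [h2]; simp
  simp only [real_inner_fin3, tao_udir_coord, e2]
  rw [hnorm]
  linear_combination (‖η₁‖⁻¹ * ‖η₂‖⁻¹) * (hsq0 - hsq1)

/-- **The isosceles degeneracy.** On the equal-input-moduli locus the coefficients `c_σ` with
`σ₀ = σ₁` vanish: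
if `η₀ + η₁ + η₂ = 0` and `‖η₀‖ = ‖η₁‖` then `c_σ(η) = 0` for every sign vector with `σ₀ = σ₁`
(any `n`; no non-collinearity needed for the vanishing direction) — the "certain degeneracy … (namely,
the failure of (c-nondeg))" which §3.2 avoids by taking base frequencies of distinct magnitudes.
[cite: Tao2016AveragedNS, §3.2 p. 15; §3.9 (3.24) p. 20; §1 footnote p. 6] -/
theorem cSigma_eq_zero_of_isosceles (η : Fin 3 → EuclideanSpace ℝ (Fin 3)) (n : EuclideanSpace ℝ (Fin 3))
    (hsum : η 0 + η 1 + η 2 = 0) (hnorm : ‖η 0‖ = ‖η 1‖)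
    (σ : Fin 3 → ℤˣ) (hσ : σ 0 = σ 1) : cSigma η n σ = 0 := by
  have hB := inner_cross_udir_swap (η 0) (η 1) n hnorm
  have hD := inner_udir_eq_of_isosceles (η 0) (η 1) (η 2) hsum hnorm
  unfold cSigma
  rw [hB, hD, hσ]
  push_cast
  ring

/-- The complementary statement: with `σ₀ ≠ σ₁` (i.e. `σ₁ = -σ₀`) the coefficient equals
`(1/8i) · 2 σ₀ · A` with `A = ((η₀/|η₀|) × n)·η₁`, hence is nonzero iff the triple is
non-collinear. [cite: Tao2016AveragedNS, §3.9 p. 20 (the coefficients `c_σ`)] -/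
theorem cSigma_eq_of_isosceles_opposite (η : Fin 3 → EuclideanSpace ℝ (Fin 3)) (n : EuclideanSpace ℝ (Fin 3))
    (hsum : η 0 + η 1 + η 2 = 0) (hnorm : ‖η 0‖ = ‖η 1‖)
    (σ : Fin 3 → ℤˣ) (hσ : σ 1 = -σ 0) :
    cSigma η n σ =
      1 / (8 * Complex.I) * (2 * ((σ 0 : ℤ) : ℂ) * (⟪cross (udir (η 0)) n, η 1⟫ : ℂ)) := by
  have hB := inner_cross_udir_swap (η 0) (η 1) n hnorm
  have hD := inner_udir_eq_of_isosceles (η 0) (η 1) (η 2) hsum hnorm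
  unfold cSigma
  rw [hB, hD, hσ]
  push_cast
  ring


/-- The two triple products in `c_σ` are proportional: `⟪u₁ × n, η₀⟫ = -(‖η₀‖/‖η₁‖) ⟪u₀ × n, η₁⟫`.
[cite: Tao2016AveragedNS, §3.9 p. 20 (the coefficients `c_σ`)] -/
theorem inner_cross_udir_swap_general (η₀ η₁ n : EuclideanSpace ℝ (Fin 3)) (h0 : η₀ ≠ 0) :
    ⟪cross (udir η₁) n, η₀⟫ = -(‖η₀‖ / ‖η₁‖) * ⟪cross (udir η₀) n, η₁⟫ := by
  have hk : ‖η₀‖ * ‖η₀‖⁻¹ = 1 := mul_inv_cancel₀ (norm_ne_zero_iff.mpr h0)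
  simp only [real_inner_fin3, cross_apply_zero, cross_apply_one, cross_apply_two, tao_udir_coord,
    div_eq_mul_inv]
  linear_combination (‖η₁‖⁻¹ * ((η₀ 1 * n 2 - η₀ 2 * n 1) * η₁ 0 + (η₀ 2 * n 0 - η₀ 0 * n 2) * η₁ 1 +
    (η₀ 0 * n 1 - η₀ 1 * n 0) * η₁ 2)) * hk

/-- `⟪u_x, u_y⟫ = ⟪x, y⟫ / (‖x‖ ‖y‖)` (`u_x = x/‖x‖`). [cite: Tao2016AveragedNS, §3.7 footnote 6 p. 19 (`u = ξ/|ξ|`)] -/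
theorem inner_udir_udir (x y : EuclideanSpace ℝ (Fin 3)) : ⟪udir x, udir y⟫ = ‖x‖⁻¹ * ‖y‖⁻¹ * ⟪x, y⟫ := by
  rw [inner_udir_right, real_inner_comm, inner_udir_right, real_inner_comm]
  ring

/-- In a closed triangle `x + y + z = 0` the angles are functions of the side lengths (law of cosines):
`⟪y, z⟫ = (‖x‖² − ‖y‖² − ‖z‖²)/2`. [cite: Tao2016AveragedNS, §3.2 (3.7) p. 15 (the closed frequency triangle `ξ⁰₁ + ξ⁰₂ + ξ⁰₃ = 0`)] -/
theorem inner_of_sum_eq_zero (x y z : EuclideanSpace ℝ (Fin 3)) (h : x + y + z = 0) :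
    ⟪y, z⟫ = (‖x‖ ^ 2 - ‖y‖ ^ 2 - ‖z‖ ^ 2) / 2 := by
  have hx : x = -(y + z) := by
    rw [← sub_eq_zero]; rw [← h]; abel
  have : ‖x‖ ^ 2 = ‖y‖ ^ 2 + 2 * ⟪y, z⟫ + ‖z‖ ^ 2 := by
    rw [hx, norm_neg]; exact norm_add_sq_real y z
  linarith

/-- **(c-nondeg) for an arbitrary non-degenerate closed triangle with distinct input moduli.**
If `η₀ + η₁ + η₂ = 0`, the side lengths satisfy the strict triangle inequalities, the triple
product `⟪u₀ × n, η₁⟫` is non-zero and `‖η₀‖ ≠ ‖η₁‖`, then every coefficient `c_σ(η, n)` is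
non-zero — Remark 3.5's "this condition in fact holds for generic `ξ⁰₁, ξ⁰₂, ξ⁰₃`" made
quantitative: for closed non-degenerate triangles, (c-nondeg) (3.24) holds exactly off the
equal-input-moduli locus. [cite: Tao2016AveragedNS, §3.9 (3.24) p. 20; Remark 3.5 p. 20; §3.2 p. 15] -/
theorem cSigma_ne_zero_of_triangle (η : Fin 3 → EuclideanSpace ℝ (Fin 3)) (n : EuclideanSpace ℝ (Fin 3)) (hsum : η 0 + η 1 + η 2 = 0)
    (hA : ⟪cross (udir (η 0)) n, η 1⟫ ≠ 0)
    (htri : ‖η 2‖ < ‖η 0‖ + ‖η 1‖ ∧ ‖η 0‖ < ‖η 1‖ + ‖η 2‖ ∧ ‖η 1‖ < ‖η 0‖ + ‖η 2‖)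
    (hab : ‖η 0‖ ≠ ‖η 1‖) (σ : Fin 3 → ℤˣ) : cSigma η n σ ≠ 0 := by
  obtain ⟨ht2, ht0, ht1⟩ := htri
  -- non-vanishing of the two inputs
  have h0 : η 0 ≠ 0 := by
    intro h; apply hA
    simp [real_inner_fin3, cross_apply_zero, cross_apply_one, cross_apply_two, tao_udir_coord, h]
  have h1 : η 1 ≠ 0 := by
    intro h; apply hA; rw [h, inner_zero_right]
  set A := ⟪cross (udir (η 0)) n, η 1⟫ with hAdef
  set a := ‖η 0‖ with hadef
  set b := ‖η 1‖ with hbdef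
  set c := ‖η 2‖ with hcdef
  have ha : 0 < a := norm_pos_iff.mpr h0
  have hb : 0 < b := norm_pos_iff.mpr h1
  have hc : 0 < c := by
    rcases (norm_nonneg (η 2)).lt_or_eq with h | h
    · exact h
    · exfalso; rw [← hcdef] at h; linarith
  -- the three identities
  have hA' : ⟪cross (udir (η 1)) n, η 0⟫ = -(a / b) * A := inner_cross_udir_swap_general _ _ _ h0
  have h12 : ⟪η 1, η 2⟫ = (a ^ 2 - b ^ 2 - c ^ 2) / 2 := inner_of_sum_eq_zero _ _ _ hsum
  have h02 : ⟪η 0, η 2⟫ = (b ^ 2 - a ^ 2 - c ^ 2) / 2 := by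
    have hs : η 1 + η 0 + η 2 = 0 := by rw [← hsum]; abel
    exact inner_of_sum_eq_zero _ _ _ hs
  have hP : ⟪udir (η 1), udir (η 2)⟫ = (a ^ 2 - b ^ 2 - c ^ 2) / (2 * b * c) := by
    rw [inner_udir_udir, h12, ← hbdef, ← hcdef]; field_simp
  have hQ : ⟪udir (η 0), udir (η 2)⟫ = (b ^ 2 - a ^ 2 - c ^ 2) / (2 * a * c) := by
    rw [inner_udir_udir, h02, ← hadef, ← hcdef]; field_simp
  -- the signs as real numbers
  set s0 : ℝ := ((σ 0 : ℤ) : ℝ) with hs0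
  set s1 : ℝ := ((σ 1 : ℤ) : ℝ) with hs1
  set s2 : ℝ := ((σ 2 : ℤ) : ℝ) with hs2
  -- the real factor
  set E : ℝ := s0 * (1 - (a ^ 2 - b ^ 2 - c ^ 2) / (2 * b * c) * s1 * s2)
      - a / b * s1 * (1 - (b ^ 2 - a ^ 2 - c ^ 2) / (2 * a * c) * s0 * s2) with hE
  have key : cSigma η n σ = 1 / (8 * Complex.I) * ((A * E : ℝ) : ℂ) := by
    unfold cSigma
    rw [hA', hP, hQ]
    simp only [hE, hs0, hs1, hs2]
    push_cast
    ring
  have h8 : (1 : ℂ) / (8 * Complex.I) ≠ 0 := by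
    rw [one_div_eight_mul_I]; simp [Complex.I_ne_zero]
  rw [key]
  refine mul_ne_zero h8 (Complex.ofReal_ne_zero.mpr (mul_ne_zero hA ?_))
  -- E ≠ 0: clear denominators, then the eight sign patterns
  have hEmul : E * (2 * b * c) =
      s0 * (2 * b * c - s1 * s2 * (a ^ 2 - b ^ 2 - c ^ 2))
        - s1 * (2 * a * c - s0 * s2 * (b ^ 2 - a ^ 2 - c ^ 2)) := by
    rw [hE]; field_simp
  intro hE0
  have hX : s0 * (2 * b * c - s1 * s2 * (a ^ 2 - b ^ 2 - c ^ 2))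
      - s1 * (2 * a * c - s0 * s2 * (b ^ 2 - a ^ 2 - c ^ 2)) = 0 := by
    rw [← hEmul, hE0, zero_mul]
  have hab' : a - b ≠ 0 := sub_ne_zero.mpr hab
  have hba' : b - a ≠ 0 := sub_ne_zero.mpr (Ne.symm hab)
  have e0 : s0 = 1 ∨ s0 = -1 := by
    rcases Int.units_eq_one_or (σ 0) with h | h <;> simp [hs0, h]
  have e1 : s1 = 1 ∨ s1 = -1 := by
    rcases Int.units_eq_one_or (σ 1) with h | h <;> simp [hs1, h]
  have e2 : s2 = 1 ∨ s2 = -1 := by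
    rcases Int.units_eq_one_or (σ 2) with h | h <;> simp [hs2, h]
  rcases e0 with e0 | e0 <;> rcases e1 with e1 | e1 <;> rcases e2 with e2 | e2 <;>
    rw [e0, e1, e2] at hX
  · -- (1,1,1): 2(b-a)(a+b+c)
    have : 2 * (b - a) * (a + b + c) = 0 := by linear_combination hX
    rcases mul_eq_zero.mp this with h | h
    · rcases mul_eq_zero.mp h with h | h
      · norm_num at h
      · exact hba' h
    · linarith
  · -- (1,1,-1): 2(a-b)(a+b-c)
    have : 2 * (a - b) * (a + b - c) = 0 := by linear_combination hX
    rcases mul_eq_zero.mp this with h | h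
    · rcases mul_eq_zero.mp h with h | h
      · norm_num at h
      · exact hab' h
    · linarith
  · -- (1,-1,1): 2(a+b)(a-b+c)
    have : 2 * (a + b) * (a - b + c) = 0 := by linear_combination hX
    rcases mul_eq_zero.mp this with h | h
    · rcases mul_eq_zero.mp h with h | h
      · norm_num at h
      · linarith
    · linarith
  · -- (1,-1,-1): 2(a+b)(b-a+c)
    have : 2 * (a + b) * (b - a + c) = 0 := by linear_combination hX
    rcases mul_eq_zero.mp this with h | h
    · rcases mul_eq_zero.mp h with h | h
      · norm_num at h
      · linarith
    · linarith
  · -- (-1,1,1)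
    have : 2 * (a + b) * (b - a + c) = 0 := by linear_combination -hX
    rcases mul_eq_zero.mp this with h | h
    · rcases mul_eq_zero.mp h with h | h
      · norm_num at h
      · linarith
    · linarith
  · -- (-1,1,-1)
    have : 2 * (a + b) * (a - b + c) = 0 := by linear_combination -hX
    rcases mul_eq_zero.mp this with h | h
    · rcases mul_eq_zero.mp h with h | h
      · norm_num at h
      · linarith
    · linarith
  · -- (-1,-1,1)
    have : 2 * (a - b) * (a + b - c) = 0 := by linear_combination -hX
    rcases mul_eq_zero.mp this with h | h
    · rcases mul_eq_zero.mp h with h | h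
      · norm_num at h
      · exact hab' h
    · linarith
  · -- (-1,-1,-1)
    have : 2 * (b - a) * (a + b + c) = 0 := by linear_combination -hX
    rcases mul_eq_zero.mp this with h | h
    · rcases mul_eq_zero.mp h with h | h
      · norm_num at h
      · exact hba' h
    · linarith


/-! ### The quantitative form: an explicit lower bound for `|c_σ|` off the isosceles locus -/

/-- The eight values of the real factor of `c_σ` (after clearing the denominator `2bc`) are
`±2(b−a)(a+b+c)`, `±2(a−b)(a+b−c)`, `±2(a+b)(a−b+c)`, `±2(a+b)(b−a+c)`; each is at least
`2|a−b|·m` in absolute value, where `m` is a common lower bound of the three triangle slacks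
`a+b−c`, `a−b+c`, `b−a+c` (and `m ≥ 0`). [cite: Tao2016AveragedNS, §3.9 p. 20 (the coefficients `c_σ`)] -/
private theorem tao_abs_signFactor_ge (s0 s1 s2 a b c m : ℝ)
    (e0 : s0 = 1 ∨ s0 = -1) (e1 : s1 = 1 ∨ s1 = -1) (e2 : s2 = 1 ∨ s2 = -1)
    (ha : 0 ≤ a) (hb : 0 ≤ b) (hc : 0 ≤ c) (hm : 0 ≤ m)
    (m1 : m ≤ a + b - c) (m2 : m ≤ a - b + c) (m3 : m ≤ b - a + c) :
    2 * |a - b| * m ≤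
      |s0 * (2 * b * c - s1 * s2 * (a ^ 2 - b ^ 2 - c ^ 2))
        - s1 * (2 * a * c - s0 * s2 * (b ^ 2 - a ^ 2 - c ^ 2))| := by
  have hab : |a - b| ≤ a + b := abs_le.2 ⟨by linarith, by linarith⟩
  have hba : |b - a| = |a - b| := abs_sub_comm b a
  have h0 : 0 ≤ |a - b| := abs_nonneg _
  -- the four shapes
  have s_ppp : 2 * |a - b| * m ≤ |2 * (b - a) * (a + b + c)| := by
    rw [abs_mul, abs_mul, hba, abs_of_nonneg (by norm_num : (0 : ℝ) ≤ 2),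
      abs_of_nonneg (by linarith : 0 ≤ a + b + c)]
    exact mul_le_mul_of_nonneg_left (by linarith) (by positivity)
  have s_ppm : 2 * |a - b| * m ≤ |2 * (a - b) * (a + b - c)| := by
    rw [abs_mul, abs_mul, abs_of_nonneg (by norm_num : (0 : ℝ) ≤ 2),
      abs_of_nonneg (by linarith : 0 ≤ a + b - c)]
    exact mul_le_mul_of_nonneg_left m1 (by positivity)
  have s_pmp : 2 * |a - b| * m ≤ |2 * (a + b) * (a - b + c)| := by
    rw [abs_mul, abs_mul, abs_of_nonneg (by norm_num : (0 : ℝ) ≤ 2), abs_of_nonneg (by linarith : 0 ≤ a + b),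
      abs_of_nonneg (by linarith : 0 ≤ a - b + c), mul_assoc, mul_assoc]
    exact mul_le_mul_of_nonneg_left (mul_le_mul hab m2 hm (by linarith)) (by norm_num)
  have s_pmm : 2 * |a - b| * m ≤ |2 * (a + b) * (b - a + c)| := by
    rw [abs_mul, abs_mul, abs_of_nonneg (by norm_num : (0 : ℝ) ≤ 2), abs_of_nonneg (by linarith : 0 ≤ a + b),
      abs_of_nonneg (by linarith : 0 ≤ b - a + c), mul_assoc, mul_assoc]
    exact mul_le_mul_of_nonneg_left (mul_le_mul hab m3 hm (by linarith)) (by norm_num)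
  rcases e0 with e0 | e0 <;> rcases e1 with e1 | e1 <;> rcases e2 with e2 | e2 <;> rw [e0, e1, e2]
  · have h : (1 : ℝ) * (2 * b * c - 1 * 1 * (a ^ 2 - b ^ 2 - c ^ 2))
        - 1 * (2 * a * c - 1 * 1 * (b ^ 2 - a ^ 2 - c ^ 2)) = 2 * (b - a) * (a + b + c) := by ring
    rw [h]; exact s_ppp
  · have h : (1 : ℝ) * (2 * b * c - 1 * (-1) * (a ^ 2 - b ^ 2 - c ^ 2))
        - 1 * (2 * a * c - 1 * (-1) * (b ^ 2 - a ^ 2 - c ^ 2)) = 2 * (a - b) * (a + b - c) := by ring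
    rw [h]; exact s_ppm
  · have h : (1 : ℝ) * (2 * b * c - (-1) * 1 * (a ^ 2 - b ^ 2 - c ^ 2))
        - (-1) * (2 * a * c - 1 * 1 * (b ^ 2 - a ^ 2 - c ^ 2)) = 2 * (a + b) * (a - b + c) := by ring
    rw [h]; exact s_pmp
  · have h : (1 : ℝ) * (2 * b * c - (-1) * (-1) * (a ^ 2 - b ^ 2 - c ^ 2))
        - (-1) * (2 * a * c - 1 * (-1) * (b ^ 2 - a ^ 2 - c ^ 2)) = 2 * (a + b) * (b - a + c) := by ring
    rw [h]; exact s_pmm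
  · have h : (-1 : ℝ) * (2 * b * c - 1 * 1 * (a ^ 2 - b ^ 2 - c ^ 2))
        - 1 * (2 * a * c - (-1) * 1 * (b ^ 2 - a ^ 2 - c ^ 2)) = -(2 * (a + b) * (b - a + c)) := by ring
    rw [h, abs_neg]; exact s_pmm
  · have h : (-1 : ℝ) * (2 * b * c - 1 * (-1) * (a ^ 2 - b ^ 2 - c ^ 2))
        - 1 * (2 * a * c - (-1) * (-1) * (b ^ 2 - a ^ 2 - c ^ 2)) = -(2 * (a + b) * (a - b + c)) := by ring
    rw [h, abs_neg]; exact s_pmp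
  · have h : (-1 : ℝ) * (2 * b * c - (-1) * 1 * (a ^ 2 - b ^ 2 - c ^ 2))
        - (-1) * (2 * a * c - (-1) * 1 * (b ^ 2 - a ^ 2 - c ^ 2)) = -(2 * (a - b) * (a + b - c)) := by ring
    rw [h, abs_neg]; exact s_ppm
  · have h : (-1 : ℝ) * (2 * b * c - (-1) * (-1) * (a ^ 2 - b ^ 2 - c ^ 2))
        - (-1) * (2 * a * c - (-1) * (-1) * (b ^ 2 - a ^ 2 - c ^ 2)) = -(2 * (b - a) * (a + b + c)) := by ring
    rw [h, abs_neg]; exact s_ppp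

/-- **Quantitative non-degeneracy (3.24) off the isosceles locus.** For every closed triangle
`η₀ + η₁ + η₂ = 0` with side lengths `a = ‖η₀‖`, `b = ‖η₁‖`, `c = ‖η₂‖`, every `n` and every sign
vector `σ`,
`‖c_σ(η, n)‖ ≥ |⟪u₀ × n, η₁⟫| · |a − b| · m / (8bc)`, `m := min (a+b−c, a−b+c, b−a+c)`
(the smallest triangle slack) — the explicit constant behind Remark 3.5's "(c-nondeg) holds for
generic `ξ⁰₁, ξ⁰₂, ξ⁰₃`": the margin in (3.24) is linear in the input-modulus gap `|a − b|`, with a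
coefficient that degenerates only with the triangle. No hypothesis other than closedness is needed
(degenerate configurations make the left side `≤ 0`). For the near-equilateral triads of the cascade
(all sides comparable to 1, Tao §3.2 p. 15) the bound reads `‖c_σ‖ ≳ |a − b|`.
[cite: Tao2016AveragedNS, §3.9 (3.24) p. 20; Remark 3.5 p. 20; §3.2 p. 15] -/
theorem norm_cSigma_ge_of_sum_eq_zero (η : Fin 3 → EuclideanSpace ℝ (Fin 3)) (n : EuclideanSpace ℝ (Fin 3))
    (hsum : η 0 + η 1 + η 2 = 0) (σ : Fin 3 → ℤˣ) :
    |⟪cross (udir (η 0)) n, η 1⟫| * |‖η 0‖ - ‖η 1‖| *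
        min (min (‖η 0‖ + ‖η 1‖ - ‖η 2‖) (‖η 0‖ - ‖η 1‖ + ‖η 2‖)) (‖η 1‖ - ‖η 0‖ + ‖η 2‖) /
        (8 * ‖η 1‖ * ‖η 2‖) ≤ ‖cSigma η n σ‖ := by
  set A := ⟪cross (udir (η 0)) n, η 1⟫ with hAdef
  set a := ‖η 0‖ with hadef
  set b := ‖η 1‖ with hbdef
  set c := ‖η 2‖ with hcdef
  set m := min (min (a + b - c) (a - b + c)) (b - a + c) with hmdef
  have ha0 : 0 ≤ a := norm_nonneg _
  have hb0 : 0 ≤ b := norm_nonneg _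
  have hc0 : 0 ≤ c := norm_nonneg _
  rcases le_or_gt m 0 with hm | hm
  · -- degenerate triangle: the left side is `≤ 0`
    have hnum : |A| * |a - b| * m ≤ 0 := mul_nonpos_of_nonneg_of_nonpos (by positivity) hm
    exact (div_nonpos_of_nonpos_of_nonneg hnum (by positivity)).trans (norm_nonneg _)
  have m1 : m ≤ a + b - c := (min_le_left _ _).trans (min_le_left _ _)
  have m2 : m ≤ a - b + c := (min_le_left _ _).trans (min_le_right _ _)
  have m3 : m ≤ b - a + c := min_le_right _ _
  have ha : 0 < a := by linarith
  have hb : 0 < b := by linarith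
  have hc : 0 < c := by linarith
  have h0 : η 0 ≠ 0 := norm_pos_iff.mp ha
  -- the identities of `cSigma_ne_zero_of_triangle`
  have hA' : ⟪cross (udir (η 1)) n, η 0⟫ = -(a / b) * A := inner_cross_udir_swap_general _ _ _ h0
  have h12 : ⟪η 1, η 2⟫ = (a ^ 2 - b ^ 2 - c ^ 2) / 2 := inner_of_sum_eq_zero _ _ _ hsum
  have h02 : ⟪η 0, η 2⟫ = (b ^ 2 - a ^ 2 - c ^ 2) / 2 := by
    have hs : η 1 + η 0 + η 2 = 0 := by rw [← hsum]; abel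
    exact inner_of_sum_eq_zero _ _ _ hs
  have hP : ⟪udir (η 1), udir (η 2)⟫ = (a ^ 2 - b ^ 2 - c ^ 2) / (2 * b * c) := by
    rw [inner_udir_udir, h12, ← hbdef, ← hcdef]; field_simp
  have hQ : ⟪udir (η 0), udir (η 2)⟫ = (b ^ 2 - a ^ 2 - c ^ 2) / (2 * a * c) := by
    rw [inner_udir_udir, h02, ← hadef, ← hcdef]; field_simp
  set s0 : ℝ := ((σ 0 : ℤ) : ℝ) with hs0
  set s1 : ℝ := ((σ 1 : ℤ) : ℝ) with hs1
  set s2 : ℝ := ((σ 2 : ℤ) : ℝ) with hs2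
  set E : ℝ := s0 * (1 - (a ^ 2 - b ^ 2 - c ^ 2) / (2 * b * c) * s1 * s2)
      - a / b * s1 * (1 - (b ^ 2 - a ^ 2 - c ^ 2) / (2 * a * c) * s0 * s2) with hE
  have key : cSigma η n σ = 1 / (8 * Complex.I) * ((A * E : ℝ) : ℂ) := by
    unfold cSigma
    rw [hA', hP, hQ]
    simp only [hE, hs0, hs1, hs2]
    push_cast
    ring
  have hEmul : E * (2 * b * c) =
      s0 * (2 * b * c - s1 * s2 * (a ^ 2 - b ^ 2 - c ^ 2))
        - s1 * (2 * a * c - s0 * s2 * (b ^ 2 - a ^ 2 - c ^ 2)) := by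
    rw [hE]; field_simp
  have e0 : s0 = 1 ∨ s0 = -1 := by
    rcases Int.units_eq_one_or (σ 0) with h | h <;> simp [hs0, h]
  have e1 : s1 = 1 ∨ s1 = -1 := by
    rcases Int.units_eq_one_or (σ 1) with h | h <;> simp [hs1, h]
  have e2 : s2 = 1 ∨ s2 = -1 := by
    rcases Int.units_eq_one_or (σ 2) with h | h <;> simp [hs2, h]
  -- `|E| ≥ |a - b| m / (bc)`
  have hEabs : 2 * |a - b| * m ≤ |E| * (2 * b * c) := by
    have h := tao_abs_signFactor_ge s0 s1 s2 a b c m e0 e1 e2 ha0 hb0 hc0 hm.le m1 m2 m3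
    rw [← hEmul, abs_mul, abs_of_pos (by positivity : (0 : ℝ) < 2 * b * c)] at h
    exact h
  have hnorm : ‖cSigma η n σ‖ = |A| * |E| / 8 := by
    rw [key, norm_mul, norm_div, norm_one, norm_mul, Complex.norm_I, mul_one, Complex.norm_real,
      Real.norm_eq_abs, abs_mul]
    norm_num
    ring
  rw [hnorm, div_le_iff₀ (by positivity)]
  have hA0 : 0 ≤ |A| := abs_nonneg _
  nlinarith [mul_le_mul_of_nonneg_left hEabs hA0]

/-- **Corollary (the near-equilateral cascade triads).** If the closed triangle has all three side
lengths in a window `[r, R]` with `0 < r` and `R < 2r` (for Tao's cascade: `r = 1`, `R` within a factor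
`1 + O(ε₀)` of `1`, §3.2 p. 15), then
`‖c_σ(η, n)‖ ≥ |⟪u₀ × n, η₁⟫| · (2r − R) · |‖η₀‖ − ‖η₁‖| / (8R²)` for all eight `σ`:
the (3.24)-margin is at least a fixed multiple of the input-modulus gap.
[cite: Tao2016AveragedNS, §3.9 (3.24) p. 20; Remark 3.5 p. 20; §3.2 p. 15] -/
theorem norm_cSigma_ge_of_sides_mem_Icc (η : Fin 3 → EuclideanSpace ℝ (Fin 3)) (n : EuclideanSpace ℝ (Fin 3))
    (hsum : η 0 + η 1 + η 2 = 0) {r R : ℝ} (hr : 0 < r) (hRr : R < 2 * r)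
    (hside : ∀ j, ‖η j‖ ∈ Set.Icc r R) (σ : Fin 3 → ℤˣ) :
    |⟪cross (udir (η 0)) n, η 1⟫| * (2 * r - R) * |‖η 0‖ - ‖η 1‖| / (8 * R ^ 2) ≤ ‖cSigma η n σ‖ := by
  have h := norm_cSigma_ge_of_sum_eq_zero η n hsum σ
  obtain ⟨ha1, ha2⟩ := hside 0
  obtain ⟨hb1, hb2⟩ := hside 1
  obtain ⟨hc1, hc2⟩ := hside 2
  set A := |⟪cross (udir (η 0)) n, η 1⟫| with hAdef
  set g := |‖η 0‖ - ‖η 1‖| with hgdef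
  set a := ‖η 0‖
  set b := ‖η 1‖
  set c := ‖η 2‖
  set m := min (min (a + b - c) (a - b + c)) (b - a + c) with hmdef
  have hR : 0 < R := by linarith
  have hb : 0 < b := by linarith
  have hc : 0 < c := by linarith
  have hA0 : 0 ≤ A := abs_nonneg _
  have hg0 : 0 ≤ g := abs_nonneg _
  have hm : 2 * r - R ≤ m := by
    simp only [hmdef, le_min_iff]
    refine ⟨⟨by linarith, by linarith⟩, by linarith⟩
  have hm0 : 0 ≤ 2 * r - R := by linarith
  -- compare the two fractions
  have step1 : A * (2 * r - R) * g / (8 * R ^ 2) ≤ A * g * m / (8 * b * c) := by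
    rw [div_le_div_iff₀ (by positivity) (by positivity)]
    have h1 : A * g * (2 * r - R) ≤ A * g * m := mul_le_mul_of_nonneg_left hm (by positivity)
    have h2 : (8 : ℝ) * b * c ≤ 8 * R ^ 2 := by nlinarith
    calc A * (2 * r - R) * g * (8 * b * c) = (A * g * (2 * r - R)) * (8 * b * c) := by ring
      _ ≤ (A * g * m) * (8 * b * c) := mul_le_mul_of_nonneg_right h1 (by positivity)
      _ ≤ (A * g * m) * (8 * R ^ 2) :=
          mul_le_mul_of_nonneg_left h2 (mul_nonneg (by positivity) (hm0.trans hm))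
  exact step1.trans h

end Literature.Analysis.FluidPDE.Tao2016

end
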